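import Summits.CriticalPhenomena.PercolationContinuityZ3.Theorems.PercNearOneGluingNoHeavyQuantIndepBlobHeavyLine
import Summits.CriticalPhenomena.PercolationContinuityZ3.Theorems.PercNearOneGluingNoHeavyQuantDIBStar
import HarnessLib

/-!
# QUANT lane R8, T-DIB — p1 g12's supporting-line / chord certificates of the heavy side as TERM rules of the root reduction
# (`RootDec.term_ge_of_heavyLine`, `RootDec.term_ge_of_heavyChords`)

builds on p205010 (kernel theorem, internal audit signed; external expert review pending)

Support file (`--supports stmt-CriticalPhenomena-4575`), QUANT lane typer seat prim-quant-stmt (gen 19), rung R8 of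
`run/shared/lean/prim/quant/LADDER.md`; asked for by prim-quant-p1 g12 (lane INBOX 2026-08-21T09:35Z: "@typer: `tail_ge_of_heavyChords` is a
TERM rule stronger than per-level Markov").  Theorems only (two wrappers through `RootDec.term_shift`), no definitions, no sorries, standard
axioms; local notation copied verbatim from `…QuantRootReduction` (`TERM[s, a, g, j] = P(s + Σ_{k open} a k ≥ j+1)`).

THE RULES (p1 g12, `…QuantIndepBlobHeavyLine`, P1-SURPLUS §23).  Split the blobs of a term into a finset `S` (the sub-floor blobs, possibly
with companions) and its complement (the heavy side, total size `A' = Σ_{k∉S} a k`, mean open mass `m' = Σ_{k∉S} a k·g k`).  Conditioning on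
the heavy side, `TERM[s, a, g, j] = E[TL_S((j − s) + 1 − N')]` with `TL_S` the restricted tail of `S` and `N'` the open mass off `S`; so
(LINE) any affine minorant `α + β n ≤ TL_S((j − s) + 1 − n)` on `0 ≤ n ≤ A'` gives `TERM ≥ α + β m'` (Jensen is an identity for affine
functions; no floor condition on the heavy gates), and (CHORDS) by one-variable convex duality it suffices that every chord of
`n ↦ TL_S((j − s) + 1 − n)` through `m'` over `[0, A']` lies above `x` (and `x ≤` the value at `m'` when `m'` is an integer).  The chord
`(n₁, n₂)` is the row of the system whose heavy side is a sure mass `n₁` plus ONE pseudo-blob `(n₂ − n₁, (m' − n₁)/(n₂ − n₁))`: the heavy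
side of Conjecture DIB\* (`Quant.IndepBlob.DIBStar`) costs at most one blob.  These are per-term certificates for R1
(`RootDec.rtail_ge_of_terms`) next to the menu of `…QuantRootReductionCertMenu`; p1 g12's Conjecture J (lane INBOX 09:35Z: every corner
instance is graded-mergeable or chord-certified with `S` = lights; 3·10⁵ + 1 900 instances, 0 failures) is not asserted here.

* `Quant.RootDec.term_ge_of_heavyLine` — `s ≤ j`, gates in `[0,1]`, an affine minorant of `n ↦ TL_S((j − s) + 1 − n)` on `n ≤ A'` with value
  `≥ x` at `m'` ⟹ `x ≤ TERM[s, a, g, j]`.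
* `Quant.RootDec.term_ge_of_heavyChords` — `s ≤ j`, gates in `[0,1]`, all chords through `m'` above `x` (and the integer point) ⟹
  `x ≤ TERM[s, a, g, j]`.

[this work]; the certificates: prim-quant-p1 g12 (this lane); the gluing rows served [cite: KozmaNitzan2024, Conjecture 3 (p. 15)]; product
weights [cite: Grimmett1999, §1.3 p. 10].
-/

namespace Summit.CriticalPhenomena.PercolationContinuityZ3.Theorems

namespace Quant

namespace RootDec

open Finset

variable {κ : Type} [Fintype κ] [DecidableEq κ]

/-- product-Bernoulli weight of the set `W` of open blobs (as in `…QuantRootReduction`) -/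
local notation3 "wt[" g ", " W "]" => ∏ k, (if k ∈ (W : Finset κ) then (g : κ → ℝ) k else 1 - (g : κ → ℝ) k)

/-- the TERM tail `P(s + Σ_{k open} a k ≥ j+1)` (as in `…QuantRootReduction`) -/
local notation3 "TERM[" s ", " a ", " g ", " j "]" =>
  ∑ W : Finset κ, wt[g, W] * (if (j : ℕ) + 1 ≤ (s : ℕ) + ∑ k ∈ W, (a : κ → ℕ) k then (1 : ℝ) else 0)

/-- **LINE — the supporting-line certificate as a TERM rule** (p1 g12's `IndepBlob.tail_ge_of_heavyLine` at layer `j − s`).  Gates in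
`[0,1]`, `s ≤ j`, `S` any finset of blobs; if `α + β·n ≤ TL_S((j − s) + 1 − n)` for all integers `n ≤ Σ_{k∉S} a k` (restricted tail of `S`,
truncated subtraction) and `x ≤ α + β·Σ_{k∉S} a k·g k`, then `x ≤ TERM[s, a, g, j]`. [this work] -/
theorem term_ge_of_heavyLine (s : ℕ) (a : κ → ℕ) (g : κ → ℝ) (j : ℕ) (hg : ∀ k, 0 ≤ g k ∧ g k ≤ 1) (hs : s ≤ j)
    (S : Finset κ) (x α β : ℝ)
    (hline : ∀ n : ℕ, n ≤ ∑ k ∈ Sᶜ, a k → α + β * n ≤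
      ∑ W ∈ S.powerset, (∏ i ∈ S, (if i ∈ W then g i else 1 - g i)) *
        (if (j - s) + 1 - n ≤ ∑ i ∈ W, a i then (1 : ℝ) else 0))
    (hm : x ≤ α + β * ∑ k ∈ Sᶜ, (a k : ℝ) * g k) : x ≤ TERM[s, a, g, j] := by
  rw [term_shift s a g j hs]
  exact IndepBlob.tail_ge_of_heavyLine g a (fun i => (hg i).1) (fun i => (hg i).2) S (j - s) x α β hline hm

/-- **CHORDS — the two-point (chord) certificate as a TERM rule** (p1 g12's `IndepBlob.tail_ge_of_heavyChords` at layer `j − s`).  Gates in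
`[0,1]`, `s ≤ j`, `S` any finset of blobs, `A' = Σ_{k∉S} a k`, `m' = Σ_{k∉S} a k·g k`, `f(n) = TL_S((j − s) + 1 − n)`.  If `x ≤ f(n)` for the
integer `n = m'` (when `m'` is an integer `≤ A'`) and every chord through `m'` lies above `x` —
`x·(n₂ − n₁) ≤ (n₂ − m')·f(n₁) + (m' − n₁)·f(n₂)` for all integers `n₁ < m' < n₂ ≤ A'` — then `x ≤ TERM[s, a, g, j]`.  (The chord `(n₁, n₂)`
= the heavy side replaced by sure `n₁` plus one pseudo-blob `(n₂ − n₁, (m' − n₁)/(n₂ − n₁))`.) [this work] -/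
theorem term_ge_of_heavyChords (s : ℕ) (a : κ → ℕ) (g : κ → ℝ) (j : ℕ) (hg : ∀ k, 0 ≤ g k ∧ g k ≤ 1) (hs : s ≤ j)
    (S : Finset κ) (x : ℝ)
    (hint : ∀ n : ℕ, n ≤ ∑ k ∈ Sᶜ, a k → (n : ℝ) = ∑ k ∈ Sᶜ, (a k : ℝ) * g k →
      x ≤ ∑ W ∈ S.powerset, (∏ i ∈ S, (if i ∈ W then g i else 1 - g i)) *
        (if (j - s) + 1 - n ≤ ∑ i ∈ W, a i then (1 : ℝ) else 0))
    (hchord : ∀ n₁ n₂ : ℕ, (n₁ : ℝ) < ∑ k ∈ Sᶜ, (a k : ℝ) * g k → (∑ k ∈ Sᶜ, (a k : ℝ) * g k) < (n₂ : ℝ) →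
      n₂ ≤ ∑ k ∈ Sᶜ, a k →
      x * ((n₂ : ℝ) - n₁) ≤
        ((n₂ : ℝ) - ∑ k ∈ Sᶜ, (a k : ℝ) * g k) *
            (∑ W ∈ S.powerset, (∏ i ∈ S, (if i ∈ W then g i else 1 - g i)) *
              (if (j - s) + 1 - n₁ ≤ ∑ i ∈ W, a i then (1 : ℝ) else 0)) +
          ((∑ k ∈ Sᶜ, (a k : ℝ) * g k) - n₁) *
            (∑ W ∈ S.powerset, (∏ i ∈ S, (if i ∈ W then g i else 1 - g i)) *
              (if (j - s) + 1 - n₂ ≤ ∑ i ∈ W, a i then (1 : ℝ) else 0))) :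
    x ≤ TERM[s, a, g, j] := by
  rw [term_shift s a g j hs]
  exact IndepBlob.tail_ge_of_heavyChords g a (fun i => (hg i).1) (fun i => (hg i).2) S (j - s) x hint hchord

end RootDec

end Quant

end Summit.CriticalPhenomena.PercolationContinuityZ3.Theorems
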